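import Summits.HodgeConjecture.HodgeConjecture.Theorems.Ring2ClassTargetsRows
import Summits.HodgeConjecture.HodgeConjecture.Theorems.Ring2AtlasOpenCells
import Literature.AlgebraicGeometry.Motives.AbelianVarietyProductDimProofs
import HarnessLib

/-!
# Ring 2 · class targets × atlas — where the five typed atlas cells sit on the dimension axis (cover lemmas)

HONEST FRAMING (cell `pub-hodge-ring2`, verbatim): research route conditional on HC_CM; not a corollary;
Q11.4-sentence-2 already refuted in dim ≥ 3.

`HC_CM` := `Theses.RankFourFaces.CMAbelianHodge` (item stmt-HodgeConjecture-3052) and `HC_AV` :=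
`Theses.PadicSemiregularLift.HodgeAbelianVarieties` (item stmt-HodgeConjecture-1333) are used by name only; the helper
target of this file is item stmt-HodgeConjecture-16267 (`Theses.RankFourFaces.CMToAbelian`), never re-filed. No fact is
asserted; no `@[conjecture]` node is declared; `HC_CM` does not occur in any hypothesis below (it is not load-bearing on
the rows concerned — see `Ring2ClassTargetsRows`).

WHAT THIS FILE DOES (LEAD duty L3.11 of `RING2-MAP.md`: "per-row cover lemmas once the atlas cells land"). The atlas seat's
five typed OPEN CELLS (`Ring2AtlasOpenCells`, p190867) are statements about POWERS `X^{N+1}` of abelian four- and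
fivefolds. On the dimension axis of `Ring2ClassTargets` (`HCAtDim g`, `HCUpToDim g`, and the residual
`Theses.SevenfoldWeilCensus.HodgeAbelianDimGeEight` = "HC for every abelian variety of dimension `≥ 8`", item
stmt-HodgeConjecture-18722 by name) they sit as follows — kernel-checked, no classification fact needed:

* `dim_powSucc` : `dim X^{N+1} = dim X · (N+1)` (from the tree's `AbelianVariety.dim_prod`);
* `hcOnClass_dimGeEight_iff` : the residual IS the class target `HCOnClass (8 ≤ dim ·)`;
* `hodgePowersOfMumfordTypeFourfold_of_hodgeAbelianDimGeEight`, `hodgePowersOfEllipticTimesFourfold13_of_hodgeAbelianDimGeEight` :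
  the two cells that only speak about `N ≥ 1` are cases of the dimension-`≥ 8` residual ALONE (dimensions `4(N+1) ≥ 8`,
  `5(N+1) ≥ 10`) — they carry no content in dimension `≤ 7`;
* `hodgePowersOfWeilTypeFourfold_of_hcAtDim_four_of_hodgeAbelianDimGeEight` (and the type-III / discriminant-1 sub-cells through
  the atlas seat's own implications) : the Weil-type power cell is a case of `HCAtDim 4 ∧ (dim ≥ 8)`; its `N = 0` slice is a
  case of `HCAtDim 4` (`hodgeConjectureFor_of_hodgePowersOfWeilTypeFourfold`), hence — granted the codimension-2 part of
  Moonen–Zarhin 1999 Thm. 0.1 as a hypothesis — of the Weil-fourfold cell `W₄` together with the residual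
  (`atlasCells_of_weilClassesFourfolds_of_hodgeAbelianDimGeEight`, using `hcAtDim_four_of_weilClassesFourfolds` of the rows file);
* `atlasCells_of_hodgeAbelianVarieties`, `atlasCells_of_hodgeConjecture` : on-path (all five cells at once).

WHAT IS NOT CLAIMED. No cell is decided; the converse "Weil power cell ⟹ `W₄`" is NOT proved here (it needs the dichotomy
"one non-zero rational `(2,2)` Weil class ⟹ all Weil classes are `(2,2)`", Moonen–Zarhin 1999 (1.9), which the tree does
not have as a theorem); nothing is said about dimension `6, 7` (the atlas's `g = 6, 7` columns with content are CM cells =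
instances of `HC_CM`, undeclared by convention C2, or the general Weil sixfold = row W of `Ring2.Hypotheses`).

## References
* [MoonenZarhin1999LowDim] B. Moonen, Yu. Zarhin, *Hodge classes on abelian varieties of low dimension*, Math. Ann. 315
  (1999) 711–733 — Thm. 0.1 (codimension-2 part, hypothesis `h01` below).
* [Deligne2000] P. Deligne, *The Hodge conjecture*, Clay problem description (2000), §1 — on-path lemmas.
* [GortzWedhorn2020] U. Görtz, T. Wedhorn, *Algebraic Geometry I*, 2nd ed. (2020), Lemma 6.26 — dimension of products
  (through the tree theorem `AbelianVariety.dim_prod`).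
-/

set_option linter.dupNamespace false

noncomputable section

open CategoryTheory

namespace Summit.HodgeConjecture.HodgeConjecture.Ring2.ClassTargets

open Literature.AlgebraicGeometry Literature.AlgebraicGeometry.Motives
open Literature.AlgebraicGeometry.HodgeTheory
open Summit.HodgeConjecture.HodgeConjecture.Theses
open Summit.HodgeConjecture.HodgeConjecture.Ring2.Atlas
open Literature.Barriers.HodgeConjecture

/-! ## §1 Dimension of powers; the dimension-≥ 8 residual as a class target -/

/-- `dim X^{N+1} = dim X · (N + 1)` for the tree's iterated product `AbelianVariety.powSucc`
(`X.powSucc 0 = X`, `X.powSucc (N+1) = X.powSucc N × X`). [cite: GortzWedhorn2020, Lemma 6.26] -/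
theorem dim_powSucc (X : AbelianVariety ℂ) : ∀ N : ℕ, (X.powSucc N).dim = X.dim * (N + 1)
  | 0 => by simp [AbelianVariety.powSucc_zero]
  | N + 1 => by
      rw [AbelianVariety.powSucc_succ, AbelianVariety.dim_prod, dim_powSucc X N]
      ring

/-- `8 ≤ dim X^{N+1}` as soon as `dim X = 4` and `N ≥ 1`. [folklore] -/
theorem eight_le_dim_powSucc_of_dim_eq_four {X : AbelianVariety ℂ} (hX : X.dim = 4) {N : ℕ} (hN : 0 < N) :
    8 ≤ (X.powSucc N).dim := by
  rw [dim_powSucc, hX]; omega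

/-- `8 ≤ dim X^{N+1}` as soon as `dim X = 5` and `N ≥ 1`. [folklore] -/
theorem eight_le_dim_powSucc_of_dim_eq_five {X : AbelianVariety ℂ} (hX : X.dim = 5) {N : ℕ} (hN : 0 < N) :
    8 ≤ (X.powSucc N).dim := by
  rw [dim_powSucc, hX]; omega

/-- The residual conjunct `HodgeAbelianDimGeEight` (item stmt-HodgeConjecture-18722, by name) IS the class target
"HC on every abelian variety of dimension `≥ 8`" (the smooth-projective guard is provable). [folklore] -/
theorem hcOnClass_dimGeEight_iff :
    HCOnClass (fun A ↦ 8 ≤ A.dim) ↔ SevenfoldWeilCensus.HodgeAbelianDimGeEight :=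
  ⟨fun h A hA _ ↦ h A hA, fun h A hA ↦ h A hA AbelianVariety.isSmoothProjective_holds⟩

/-- Pointwise form of the residual: HC for any abelian variety of dimension `≥ 8`. [folklore] -/
theorem hodgeConjectureFor_of_hodgeAbelianDimGeEight (h8 : SevenfoldWeilCensus.HodgeAbelianDimGeEight)
    (A : AbelianVariety ℂ) (hA : 8 ≤ A.dim) : HodgeConjectureFor A.dim A.X :=
  h8 A hA AbelianVariety.isSmoothProjective_holds

/-! ## §2 The two cells that live in dimension ≥ 8 only -/

/-- **Cover lemma (Mumford-type powers).** `HodgePowersOfMumfordTypeFourfold` speaks only about `X^{N+1}` with `N ≥ 1`,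
i.e. about abelian varieties of dimension `4(N+1) ≥ 8`: it is a case of the dimension-`≥ 8` residual alone and carries no
content on the rows `g ≤ 7` of the class-target axis. [cite: MoonenZarhin1999LowDim, Thm. 0.1 (3)] -/
theorem hodgePowersOfMumfordTypeFourfold_of_hodgeAbelianDimGeEight (h8 : SevenfoldWeilCensus.HodgeAbelianDimGeEight) :
    HodgePowersOfMumfordTypeFourfold :=
  fun A hA _ N hN ↦
    hodgeConjectureFor_of_hodgeAbelianDimGeEight h8 (A.powSucc N) (eight_le_dim_powSucc_of_dim_eq_four hA hN)

/-- **Cover lemma (`E × Y`, `Y` a simple fourfold of type IV with multiplicity (1,3)).** `HodgePowersOfEllipticTimesFourfold13`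
speaks only about `(E × Y)^{N+1}` with `N ≥ 1`, of dimension `5(N+1) ≥ 10`: again a case of the dimension-`≥ 8` residual alone.
[cite: MoonenZarhin1999LowDim, Thm. 0.2 (3)] -/
theorem hodgePowersOfEllipticTimesFourfold13_of_hodgeAbelianDimGeEight (h8 : SevenfoldWeilCensus.HodgeAbelianDimGeEight) :
    HodgePowersOfEllipticTimesFourfold13 := by
  intro E Y _ _ _ _ hE hY _ _ _ _ N hN
  refine hodgeConjectureFor_of_hodgeAbelianDimGeEight h8 _ ?_
  have h5 : (E.prod Y).dim = 5 := by rw [AbelianVariety.dim_prod, hE, hY]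
  exact eight_le_dim_powSucc_of_dim_eq_five h5 hN

/-! ## §3 The Weil-type power cell = (row `g = 4`) ∧ (dimension ≥ 8) -/

/-- The `N = 0` slice of the Weil-type power cell is a statement in dimension 4: HC for every abelian fourfold carrying a
Weil-type datum `(φ, d)` whose Weil classes are of Hodge type `(2,2)`. [folklore] -/
theorem hodgeConjectureFor_of_hodgePowersOfWeilTypeFourfold (h : HodgePowersOfWeilTypeFourfold)
    (A : AbelianVariety ℂ) (φ : A ⟶ A) (d : ℕ) (hd : 0 < d) (hA : A.dim = 4) (hφ : φ ≫ φ = -(d • 𝟙 A))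
    (hW : ∀ c ∈ weilClassesOf A φ 2 d, IsOfHodgeType 4 A.X 4 2 2 c) :
    HodgeConjectureFor A.dim A.X :=
  h A φ d hd hA hφ hW 0

/-- **Cover lemma (Weil-type powers).** `HCAtDim 4` (row `g = 4`) and the dimension-`≥ 8` residual give the Weil-type
power cell: `N = 0` is the row, `N ≥ 1` is the residual. [cite: MoonenZarhin1999LowDim, Thm. 0.1 (2), (4)] -/
theorem hodgePowersOfWeilTypeFourfold_of_hcAtDim_four_of_hodgeAbelianDimGeEight (h4 : HCAtDim 4)
    (h8 : SevenfoldWeilCensus.HodgeAbelianDimGeEight) : HodgePowersOfWeilTypeFourfold := by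
  intro A φ d _ hA _ _ N
  rcases Nat.eq_zero_or_pos N with rfl | hN
  · exact h4 A hA
  · exact hodgeConjectureFor_of_hodgeAbelianDimGeEight h8 _ (eight_le_dim_powSucc_of_dim_eq_four hA hN)

/-- The type-III power cell from the same two inputs (through the atlas seat's
`hodgePowersOfTypeIIIFourfold_of_weilTypeFourfold`). [cite: MoonenZarhin1999LowDim, Thm. 0.1 (2)] -/
theorem hodgePowersOfTypeIIIFourfold_of_hcAtDim_four_of_hodgeAbelianDimGeEight (h4 : HCAtDim 4)
    (h8 : SevenfoldWeilCensus.HodgeAbelianDimGeEight) : HodgePowersOfTypeIIIFourfold :=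
  hodgePowersOfTypeIIIFourfold_of_weilTypeFourfold
    (hodgePowersOfWeilTypeFourfold_of_hcAtDim_four_of_hodgeAbelianDimGeEight h4 h8)

/-- The discriminant-1 power sub-cell from the same two inputs (through the atlas seat's
`hodgePowersOfDiscOneWeilFourfold_of_weilTypeFourfold`; in print this sub-cell is Floccari–Fu 2026, a refereed theorem,
entering the tree only as a named fact). [cite: MoonenZarhin1999LowDim, Thm. 0.1 (2)] -/
theorem hodgePowersOfDiscOneWeilFourfold_of_hcAtDim_four_of_hodgeAbelianDimGeEight (h4 : HCAtDim 4)
    (h8 : SevenfoldWeilCensus.HodgeAbelianDimGeEight) : HodgePowersOfDiscOneWeilFourfold :=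
  hodgePowersOfDiscOneWeilFourfold_of_weilTypeFourfold
    (hodgePowersOfWeilTypeFourfold_of_hcAtDim_four_of_hodgeAbelianDimGeEight h4 h8)

/-! ## §4 All five cells at once; the version over the Weil-fourfold cell `W₄`; on-path -/

/-- **All five typed atlas cells are cases of `HCAtDim 4 ∧ (HC in dimension ≥ 8)`** — no classification fact used.
[cite: MoonenZarhin1999LowDim, Thm. 0.1 and 0.2] -/
theorem atlasCells_of_hcAtDim_four_of_hodgeAbelianDimGeEight (h4 : HCAtDim 4)
    (h8 : SevenfoldWeilCensus.HodgeAbelianDimGeEight) :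
    HodgePowersOfMumfordTypeFourfold ∧ HodgePowersOfWeilTypeFourfold ∧ HodgePowersOfDiscOneWeilFourfold ∧
      HodgePowersOfTypeIIIFourfold ∧ HodgePowersOfEllipticTimesFourfold13 :=
  ⟨hodgePowersOfMumfordTypeFourfold_of_hodgeAbelianDimGeEight h8,
    hodgePowersOfWeilTypeFourfold_of_hcAtDim_four_of_hodgeAbelianDimGeEight h4 h8,
    hodgePowersOfDiscOneWeilFourfold_of_hcAtDim_four_of_hodgeAbelianDimGeEight h4 h8,
    hodgePowersOfTypeIIIFourfold_of_hcAtDim_four_of_hodgeAbelianDimGeEight h4 h8,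
    hodgePowersOfEllipticTimesFourfold13_of_hodgeAbelianDimGeEight h8⟩

/-- **The same over the Weil-fourfold cell.** Granted the codimension-2 part of Moonen–Zarhin 1999 Thm. 0.1 (hypothesis
`h01`, refereed, not proved in the tree), the Weil-fourfold cell `W₄` (`Markman2025_weilClasses_algebraic_abelianFourfold`,
the typed statement; refereed for `k = ℚ(i), ℚ(√-3)` and for discriminant 1, UNREFEREED in general) and the dimension-`≥ 8`
residual give all five atlas cells (`hcAtDim_four_of_weilClassesFourfolds` of the rows file supplies `HCAtDim 4`).
[cite: MoonenZarhin1999LowDim, Thm. 0.1 (2), (4)] -/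
theorem atlasCells_of_weilClassesFourfolds_of_hodgeAbelianDimGeEight
    (h01 : MoonenZarhin1999_codimTwoHodgeClasses_abelianFourfold)
    (hW : Markman2025_weilClasses_algebraic_abelianFourfold) (h8 : SevenfoldWeilCensus.HodgeAbelianDimGeEight) :
    HodgePowersOfMumfordTypeFourfold ∧ HodgePowersOfWeilTypeFourfold ∧ HodgePowersOfDiscOneWeilFourfold ∧
      HodgePowersOfTypeIIIFourfold ∧ HodgePowersOfEllipticTimesFourfold13 :=
  atlasCells_of_hcAtDim_four_of_hodgeAbelianDimGeEight (hcAtDim_four_of_weilClassesFourfolds h01 hW) h8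

/-- ON-PATH: all five cells are cases of `HC_AV` (item stmt-HodgeConjecture-1333). [cite: Deligne2000, §1] -/
theorem atlasCells_of_hodgeAbelianVarieties (h : PadicSemiregularLift.HodgeAbelianVarieties) :
    HodgePowersOfMumfordTypeFourfold ∧ HodgePowersOfWeilTypeFourfold ∧ HodgePowersOfDiscOneWeilFourfold ∧
      HodgePowersOfTypeIIIFourfold ∧ HodgePowersOfEllipticTimesFourfold13 :=
  atlasCells_of_hcAtDim_four_of_hodgeAbelianDimGeEight (fun A _ ↦ h A)
    ((hodgeAbelianVarieties_iff_hcUpToDim_seven_and_dimGeEight.mp h).2)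

/-- ON-PATH: all five cells are cases of the summit statement. [cite: Deligne2000, §1] -/
theorem atlasCells_of_hodgeConjecture (h : _root_.HodgeConjecture) :
    HodgePowersOfMumfordTypeFourfold ∧ HodgePowersOfWeilTypeFourfold ∧ HodgePowersOfDiscOneWeilFourfold ∧
      HodgePowersOfTypeIIIFourfold ∧ HodgePowersOfEllipticTimesFourfold13 :=
  atlasCells_of_hodgeAbelianVarieties fun _ ↦ h AbelianVariety.isSmoothProjective_holds

/-- Under `HC_CM` nothing changes on these cells: `HC_CM` is not an input of any cover lemma above (the cells concern
non-CM members or powers in dimension `≥ 8`); recorded as the trivial weakening for the map's KIND column ("ABSENT").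
[folklore] -/
theorem atlasCells_of_hcAtDim_four_of_hodgeAbelianDimGeEight_of_hcCM (_hCM : RankFourFaces.CMAbelianHodge)
    (h4 : HCAtDim 4) (h8 : SevenfoldWeilCensus.HodgeAbelianDimGeEight) :
    HodgePowersOfMumfordTypeFourfold ∧ HodgePowersOfWeilTypeFourfold ∧ HodgePowersOfDiscOneWeilFourfold ∧
      HodgePowersOfTypeIIIFourfold ∧ HodgePowersOfEllipticTimesFourfold13 :=
  atlasCells_of_hcAtDim_four_of_hodgeAbelianDimGeEight h4 h8

end Summit.HodgeConjecture.HodgeConjecture.Ring2.ClassTargets
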